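import Mathlib
import HarnessLib
import Summits.Ventures.LatticeQCDFlow.Scaling.Wilson2DU1PlaquetteDensity

/-!
# LatticeQCDFlow / Scaling — two dimensions, `U(1)`: the law of the holonomy around two adjacent
# plaquettes (a "domino") is `(K_w w)·(K_w^{L²−3} w) dHaar`

HONEST FRAMING: exact (Metropolis-corrected) sampling algorithms for lattice gauge theory;
figures of merit are autocorrelation/cost numbers at stated couplings and volumes; no
continuum-physics claim.

Venture `LatticeQCDFlow` (cell pub-lqcd), topic `Scaling`, FANOUT row 30 (lean-1, GEN-18) — OUR WORK towards
THEORY-2 §4 row C5 in the gauge case: the TWO-PLAQUETTE step after the one-plaquette law of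
`Scaling/Wilson2DU1PlaquetteDensity` (GEN-17).  On `(ℤ/L)²`, `L ≥ 2`, the domino at `x` is the pair of
plaquettes `(x; 0, 1)` and `(x + e₀; 0, 1)`, glued along the shared link `ℓ = (x + e₀, 1)`; its
holonomy is the product of the two plaquette holonomies — for an abelian group a word in the SIX
boundary links in which `ℓ` has cancelled:

* §1 `plaquetteHolonomy_mul_shift_zero` — `hol_x · hol_{x+e₀} = U_{(x,0)}·[U_{(x+e₀,0)} U_{(x+2e₀,1)}
  U_{(x+e₀+e₁,0)}⁻¹]·[U_{(x+e₁,0)}⁻¹ U_{(x,1)}⁻¹]` (commutative `G`); `dominoHolonomy_update_first` —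
  redrawing the link `(x, 0)` multiplies it on the left; `integral_comp_dominoHolonomy_mul` — hence for a
  factor `N` blind to `U_{(x,0)}`, `∫ H(hol_x hol_{x+e₀})·N dHaar^{⊗E} = (∫ H dHaar)·∫ N dHaar^{⊗E}`
  (bounded measurable data, any compact group); geometry of the domino (`shift_zero_shift_one_ne`,
  `site_shift_injective`).
* §2 **`wilson2D_u1_setIntegral_dominoHolonomy_eq`** — THE LAW OF THE DOMINO HOLONOMY of the
  two-dimensional `U(1)` Wilson weight: for every measurable `A ⊆ U(1)`,
  `∫ 1_A(hol_x U · hol_{x+e₀} U) e^{−β S_W(U)} dHaar^{⊗E}(U) = ∫_A ((K_w w)·(K_w^{L²−3} w)).toReal dHaar`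
  (`β ≥ 0`; the exact plaquette-marginal formula of `Scaling/PlaquetteMarginals2D` with the two plaquettes
  retained and the puncture at `x + e₁`, then `∫∫ ψ(ab) w(a) w(b) = ∫ ψ·(K_w w)` by self-adjointness of
  `K_w`, `Scaling/HaarConvolutionRatio`).

With `Scaling/U1ConvolutionFirstPowerStrict` (the density is continuous and not a.e. constant for
`β > 0`) this feeds `Scaling/AutoregressiveGaugeDominoReads`: the link closing a plaquette reads the far
boundary of the adjacent plaquette through the integrated shared link.  NOT CLAIMED: non-abelian groups,
`d ≥ 3`, longer chains of plaquettes (the same computation gives `(K_w^{m−1} w)(h)·(K_w^{L²−1−m} w)(h)` for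
a simply connected union of `m` plaquettes; not typed here); any number of ours.  Elementary over the
parents; no `def`; nothing is cited as a fact; no `sorry`.
-/

noncomputable section

namespace Summit.Ventures.LatticeQCDFlow.Theory2.Autoregressive

open MeasureTheory Function Set
open Literature.MathematicalPhysics.QuantumFieldTheory Literature.MathematicalPhysics.QuantumLattice
open Summit.Ventures.LatticeQCDFlow.Exactness Summit.Ventures.LatticeQCDFlow.Theory2.HaarConv
open Summit.Ventures.LatticeQCDFlow.Theory2.Lattice.TwoDim (measurable_circle_re abs_circle_re_le_one
  lintegral_weight_mul_eq_iterate lmarginal_weight_prod_eq_iterate lmarginal_eq_self_of_indep)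
open scoped ENNReal

variable {L : ℕ}

/-! ## §1 Geometry and algebra of the domino `(x; 0, 1) ∪ (x + e₀; 0, 1)` -/

/-- On `(ℤ/L)²`, `L ≥ 2`: `z + e₀ + e₁ ≠ z`. [ours] -/
theorem shift_zero_shift_one_ne (hL : 2 ≤ L) (z : Site 2 L) : (z.shift 0).shift 1 ≠ z := by
  haveI : Fact (1 < L) := ⟨hL⟩
  intro h
  have h0 := congrFun h 0
  simp [Site.shift] at h0

/-- Unit shifts of the torus are injective. [ours] -/
theorem site_shift_injective {d : ℕ} (i : Fin d) : Injective fun z : Site d L => z.shift i := by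
  intro a b h
  simpa [Site.shift] using h

/-- On `(ℤ/L)²`, `L ≥ 2`: `x + e₁ ≠ x + e₀`. [ours] -/
theorem shift_one_ne_shift_zero (hL : 2 ≤ L) (x : Site 2 L) : x.shift 1 ≠ x.shift 0 := by
  haveI : Fact (1 < L) := ⟨hL⟩
  intro h
  have h1 := congrFun h 1
  simp [Site.shift] at h1

/-- **The domino holonomy as a word in the six boundary links** (commutative `G`): the shared link
`(x + e₀, 1)` cancels between `hol_x` and `hol_{x+e₀}`. [ours] -/
theorem plaquetteHolonomy_mul_shift_zero {G : Type*} [CommGroup G] (U : GaugeConfig 2 L G) (x : Site 2 L) :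
    plaquetteHolonomy U x 0 1 * plaquetteHolonomy U (x.shift 0) 0 1 =
      U (x, 0) * ((U (x.shift 0, 0) * U ((x.shift 0).shift 0, 1) * (U ((x.shift 0).shift 1, 0))⁻¹) *
        ((U (x.shift 1, 0))⁻¹ * (U (x, 1))⁻¹)) := by
  have h1 : plaquetteHolonomy U x 0 1 =
      (U (x, 0) * ((U (x.shift 1, 0))⁻¹ * (U (x, 1))⁻¹)) * U (x.shift 0, 1) := by
    simp only [plaquetteHolonomy]; ac_rfl
  have h2 : plaquetteHolonomy U (x.shift 0) 0 1 =
      (U (x.shift 0, 1))⁻¹ *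
        (U (x.shift 0, 0) * U ((x.shift 0).shift 0, 1) * (U ((x.shift 0).shift 1, 0))⁻¹) := by
    simp only [plaquetteHolonomy]; ac_rfl
  rw [h1, h2, mul_assoc, mul_inv_cancel_left]
  ac_rfl

/-- Redrawing the first link `(x, 0)` multiplies the domino holonomy on the left (the five other
boundary links are different links; `L ≥ 2`). [ours] -/
theorem dominoHolonomy_update_first {G : Type*} [CommGroup G] (hL : 2 ≤ L) (U : GaugeConfig 2 L G)
    (x : Site 2 L) (v : G) :
    plaquetteHolonomy (update U (x, 0) v) x 0 1 * plaquetteHolonomy (update U (x, 0) v) (x.shift 0) 0 1 =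
      v * ((U (x.shift 0, 0) * U ((x.shift 0).shift 0, 1) * (U ((x.shift 0).shift 1, 0))⁻¹) *
        ((U (x.shift 1, 0))⁻¹ * (U (x, 1))⁻¹)) := by
  have h01 : (0 : Fin 2) ≠ 1 := by decide
  have n1 : ((x.shift 0, (0 : Fin 2)) : Edge 2 L) ≠ (x, 0) := fun h =>
    site_shift_ne hL x 0 (congrArg Prod.fst h)
  have n2 : (((x.shift 0).shift 0, (1 : Fin 2)) : Edge 2 L) ≠ (x, 0) := fun h =>
    h01 (congrArg Prod.snd h).symm
  have n3 : (((x.shift 0).shift 1, (0 : Fin 2)) : Edge 2 L) ≠ (x, 0) := fun h =>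
    shift_zero_shift_one_ne hL x (congrArg Prod.fst h)
  have n4 : ((x.shift 1, (0 : Fin 2)) : Edge 2 L) ≠ (x, 0) := fun h =>
    site_shift_ne hL x 1 (congrArg Prod.fst h)
  have n5 : ((x, (1 : Fin 2)) : Edge 2 L) ≠ (x, 0) := fun h => h01 (congrArg Prod.snd h).symm
  rw [plaquetteHolonomy_mul_shift_zero, update_self, update_of_ne n1, update_of_ne n2, update_of_ne n3,
    update_of_ne n4, update_of_ne n5]

/-- **Redrawing the first link makes the domino holonomy Haar, independently of any factor blind to
that link**: for bounded measurable `H : G → ℝ` and bounded measurable `N` with `N(U[(x,0) ↦ v]) = N(U)`,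
`∫ H(hol_x U · hol_{x+e₀} U)·N(U) dHaar^{⊗E}(U) = (∫ H dHaar)·∫ N dHaar^{⊗E}` (any compact commutative
`G`; Fubini over the link `(x, 0)` and right invariance of Haar). [ours] -/
theorem integral_comp_dominoHolonomy_mul {G : Type*} [CommGroup G] [TopologicalSpace G]
    [IsTopologicalGroup G] [CompactSpace G] [SecondCountableTopology G] [MeasurableSpace G] [BorelSpace G]
    [NeZero L] (hL : 2 ≤ L) (x : Site 2 L) {H : G → ℝ} (hHm : Measurable H) {C : ℝ} (hHb : ∀ g, |H g| ≤ C)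
    {N : GaugeConfig 2 L G → ℝ} (hNm : Measurable N) {C' : ℝ} (hNb : ∀ U, |N U| ≤ C')
    (hN : ∀ U v, N (update U (x, 0) v) = N U) :
    ∫ U, H (plaquetteHolonomy U x 0 1 * plaquetteHolonomy U (x.shift 0) 0 1) * N U
        ∂Measure.pi (fun _ : Edge 2 L => haarProbability G) =
      (∫ g, H g ∂(haarProbability G)) * ∫ U, N U ∂Measure.pi (fun _ : Edge 2 L => haarProbability G) := by
  set μ := haarProbability G with hμ
  have huniv : (fun _ : Edge 2 L => μ) (x, 0) Set.univ ≠ 0 := by simp [hμ]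
  have hhm : Measurable fun U : GaugeConfig 2 L G =>
      plaquetteHolonomy U x 0 1 * plaquetteHolonomy U (x.shift 0) 0 1 :=
    (measurable_plaquetteHolonomy x 0 1).mul (measurable_plaquetteHolonomy (x.shift 0) 0 1)
  have hFm : Measurable fun U : GaugeConfig 2 L G =>
      H (plaquetteHolonomy U x 0 1 * plaquetteHolonomy U (x.shift 0) 0 1) * N U :=
    (hHm.comp hhm).mul hNm
  have hC : 0 ≤ C := (abs_nonneg _).trans (hHb 1)
  have hFi : Integrable (fun U : GaugeConfig 2 L G =>
      H (plaquetteHolonomy U x 0 1 * plaquetteHolonomy U (x.shift 0) 0 1) * N U)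
      (Measure.pi fun _ : Edge 2 L => μ) :=
    Integrable.mono' (integrable_const (C * C')) hFm.aestronglyMeasurable
      (ae_of_all _ fun U => by
        rw [Real.norm_eq_abs, abs_mul]
        exact mul_le_mul (hHb _) (hNb _) (abs_nonneg _) hC)
  rw [integral_pi_eq_integral_integral_update' (fun _ : Edge 2 L => μ) (x, 0) huniv hFi]
  simp only [measure_univ, inv_one, ENNReal.toReal_one, one_smul]
  have hinner : ∀ U : GaugeConfig 2 L G,
      ∫ v, H (plaquetteHolonomy (update U (x, 0) v) x 0 1 *
          plaquetteHolonomy (update U (x, 0) v) (x.shift 0) 0 1) * N (update U (x, 0) v) ∂μ =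
        (∫ g, H g ∂μ) * N U := by
    intro U
    simp only [dominoHolonomy_update_first hL U x, hN]
    rw [integral_mul_const]
    congr 1
    exact integral_mul_right_eq_self H _
  simp_rw [hinner]
  rw [integral_const_mul]

/-! ## §2 The law of the domino holonomy of the 2-d `U(1)` Wilson weight -/

section TwoDimU1

variable [NeZero L] (β : ℝ)

/-- `∫∫ ψ(a·b) w(a) w(b) da db = ∫ ψ·(K_w w)` — the two retained plaquette variables integrate to the
first convolution power (self-adjointness of `K_w`; any measurable `ψ`). [ours] -/
theorem lintegral_pair_weight_eq (x : Site 2 L) (hx : x ≠ x.shift 0) {ψ : Circle → ℝ≥0∞}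
    (hψ : Measurable ψ) :
    ∫⁻ g : Site 2 L → Circle, ψ (g x * g (x.shift 0)) * (u1W β (g x) * u1W β (g (x.shift 0)))
        ∂(Measure.pi fun _ : Site 2 L => haarProbability Circle) =
      ∫⁻ u, ψ u * haarConv (u1W β) (u1W β) u ∂(haarProbability Circle) := by
  classical
  set w := u1W β with hw
  have hwm : Measurable w := measurable_u1W β
  set R : Finset (Site 2 L) := {x, x.shift 0} with hR
  have hprod : ∀ g : Site 2 L → Circle, ∏ r ∈ R, g r = g x * g (x.shift 0) := fun g =>
    Finset.prod_pair hx
  have hprodw : ∀ g : Site 2 L → Circle, ∏ r ∈ R, w (g r) = w (g x) * w (g (x.shift 0)) := fun g =>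
    Finset.prod_pair (f := fun r => w (g r)) hx
  -- the integrand in the format of `lmarginal_weight_prod_eq_iterate` with `a = 1`
  have hform : (fun g : Site 2 L → Circle => ψ (g x * g (x.shift 0)) * (w (g x) * w (g (x.shift 0)))) =
      fun g => ψ ((fun _ : Site 2 L → Circle => (1 : Circle)) g * ∏ r ∈ R, g r) * ∏ r ∈ R, w (g r) := by
    funext g; rw [hprod, hprodw, one_mul]
  have hmeas : Measurable fun g : Site 2 L → Circle =>
      ψ ((fun _ : Site 2 L → Circle => (1 : Circle)) g * ∏ r ∈ R, g r) * ∏ r ∈ R, w (g r) :=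
    (hψ.comp (measurable_const.mul (Finset.measurable_prod _ fun i _ => measurable_pi_apply i))).mul
      (Finset.measurable_prod _ fun i _ => hwm.comp (measurable_pi_apply i))
  have hmarg := lmarginal_weight_prod_eq_iterate (L := L) hwm hψ R (a := fun _ => (1 : Circle))
    measurable_const (fun _ _ _ _ => rfl)
  have hcard : R.card = 2 := Finset.card_pair hx
  rw [hcard] at hmarg
  -- integrate: the `lmarginal` over `R` is the constant `(K_w² ψ)(1)`
  have hconst : (∫⋯∫⁻_R, (fun g : Site 2 L → Circle =>
      ψ ((fun _ : Site 2 L → Circle => (1 : Circle)) g * ∏ r ∈ R, g r) * ∏ r ∈ R, w (g r))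
        ∂fun _ : Site 2 L => haarProbability Circle) =
      ∫⋯∫⁻_R, (fun _ : Site 2 L → Circle => (haarConv w)^[2] ψ 1) ∂fun _ : Site 2 L => haarProbability Circle := by
    rw [hmarg, lmarginal_eq_self_of_indep (haarProbability Circle) R (fun _ _ => rfl)]
  rw [hform, lintegral_eq_of_lmarginal_eq R hmeas measurable_const hconst, lintegral_const, measure_univ,
    mul_one]
  -- `(K_w² ψ)(1) = ∫ (K_w ψ)·w = ∫ ψ·(K_w w)`
  show (haarConv w)^[2] ψ 1 = ∫⁻ u, ψ u * haarConv w w u ∂(haarProbability Circle)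
  rw [show (2 : ℕ) = 1 + 1 from rfl, Function.iterate_succ_apply', Function.iterate_one]
  unfold haarConv
  simp only [one_mul]
  exact lintegral_haarConv_mul hwm (u1W_symm β) hψ hwm

/-- **THE LAW OF THE DOMINO HOLONOMY of the 2-d `U(1)` Wilson weight**: for every measurable
`A ⊆ U(1)`, `∫ 1_A(hol_x U · hol_{x+e₀} U) · e^{−β S_W(U)} dHaar^{⊗E}(U) =
∫_A ((K_w w_β)·(K_w^{L²−3} w_β)).toReal dHaar` (`β ≥ 0`, `L ≥ 2`). [ours] -/
theorem wilson2D_u1_setIntegral_dominoHolonomy_eq (hL : 2 ≤ L) (hβ : 0 ≤ β) (x : Site 2 L)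
    {A : Set Circle} (hA : MeasurableSet A) :
    ∫ U, A.indicator (fun _ => (1 : ℝ)) (plaquetteHolonomy U x 0 1 * plaquetteHolonomy U (x.shift 0) 0 1) *
        Real.exp (-β * wilsonAction u1Rep U) ∂Measure.pi (fun _ : Edge 2 L => haarProbability Circle) =
      ∫ g in A, (haarConv (u1W β) (u1W β) g * (haarConv (u1W β))^[L ^ 2 - 3] (u1W β) g).toReal
        ∂(haarProbability Circle) := by
  classical
  set w := u1W β with hw
  have hwm : Measurable w := measurable_u1W β
  obtain ⟨hFm, hFb, -⟩ := wilsonWeight_two_u1_props (L := L) β hβ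
  have hx0 : x ≠ x.shift 0 := (site_shift_ne hL x 0).symm
  have hx10 : x.shift 1 ≠ x.shift 0 := shift_one_ne_shift_zero hL x
  let φ : Circle → ℝ := A.indicator fun _ => 1
  have hφm : Measurable φ := measurable_const.indicator hA
  have hφb : ∀ g, |φ g| ≤ 1 := fun g => by
    simp only [φ, Set.indicator_apply]; split_ifs <;> simp
  have hφnn : ∀ g, 0 ≤ φ g := fun g => by
    simp only [φ, Set.indicator_apply]; split_ifs <;> simp
  have hK1le : ∀ g, haarConv w w g ≤ 1 := fun g => by
    have h := iterate_apply_le_one hwm (u1W_le_one hβ) 1 g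
    rwa [Function.iterate_one] at h
  have hKle : ∀ g, haarConv w w g * (haarConv w)^[L ^ 2 - 3] w g ≤ 1 := fun g =>
    mul_le_one' (hK1le g) (iterate_apply_le_one hwm (u1W_le_one hβ) _ g)
  have hDm : Measurable fun g => (haarConv w w g * (haarConv w)^[L ^ 2 - 3] w g).toReal :=
    ((measurable_haarConv hwm hwm).mul (measurable_iterate hwm hwm _)).ennreal_toReal
  have hDb : ∀ g, |(haarConv w w g * (haarConv w)^[L ^ 2 - 3] w g).toReal| ≤ 1 := fun g => by
    rw [abs_of_nonneg ENNReal.toReal_nonneg]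
    exact ENNReal.toReal_le_of_le_ofReal zero_le_one (by simpa using hKle g)
  -- right side as `∫ φ · D`
  have hset : ∫ g in A, (haarConv w w g * (haarConv w)^[L ^ 2 - 3] w g).toReal ∂(haarProbability Circle) =
      ∫ g, φ g * (haarConv w w g * (haarConv w)^[L ^ 2 - 3] w g).toReal ∂(haarProbability Circle) := by
    rw [← integral_indicator hA]
    refine integral_congr_ae (ae_of_all _ fun g => ?_)
    simp only [φ, Set.indicator_apply]
    split_ifs <;> simp
  rw [hset]
  -- both sides are integrals of non-negative functions: go through `lintegral`
  have hLnn : ∀ U : GaugeConfig 2 L Circle,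
      0 ≤ φ (plaquetteHolonomy U x 0 1 * plaquetteHolonomy U (x.shift 0) 0 1) *
        Real.exp (-β * wilsonAction u1Rep U) := fun U => mul_nonneg (hφnn _) (Real.exp_pos _).le
  have hRnn : ∀ g, 0 ≤ φ g * (haarConv w w g * (haarConv w)^[L ^ 2 - 3] w g).toReal := fun g =>
    mul_nonneg (hφnn _) ENNReal.toReal_nonneg
  have hhm : Measurable fun U : GaugeConfig 2 L Circle =>
      plaquetteHolonomy U x 0 1 * plaquetteHolonomy U (x.shift 0) 0 1 :=
    (measurable_plaquetteHolonomy x 0 1).mul (measurable_plaquetteHolonomy (x.shift 0) 0 1)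
  have hLi : Integrable (fun U : GaugeConfig 2 L Circle =>
      φ (plaquetteHolonomy U x 0 1 * plaquetteHolonomy U (x.shift 0) 0 1) *
        Real.exp (-β * wilsonAction u1Rep U)) (Measure.pi fun _ : Edge 2 L => haarProbability Circle) :=
    Integrable.mono' (integrable_const (1 * 1)) (((hφm.comp hhm).mul hFm).aestronglyMeasurable)
      (ae_of_all _ fun U => by
        rw [Real.norm_eq_abs, abs_mul]
        exact mul_le_mul (hφb _) (hFb _) (abs_nonneg _) zero_le_one)
  have hRi : Integrable (fun g => φ g * (haarConv w w g * (haarConv w)^[L ^ 2 - 3] w g).toReal)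
      (haarProbability Circle) :=
    Integrable.mono' (integrable_const (1 * 1)) ((hφm.mul hDm).aestronglyMeasurable)
      (ae_of_all _ fun g => by
        rw [Real.norm_eq_abs, abs_mul]
        exact mul_le_mul (hφb _) (hDb _) (abs_nonneg _) zero_le_one)
  rw [integral_eq_lintegral_of_nonneg_ae (ae_of_all _ hLnn) hLi.aestronglyMeasurable,
    integral_eq_lintegral_of_nonneg_ae (ae_of_all _ hRnn) hRi.aestronglyMeasurable]
  congr 1
  -- left side in the format of `lintegral_weight_mul_eq_iterate`
  have hLpt : ∀ U : GaugeConfig 2 L Circle,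
      ENNReal.ofReal (φ (plaquetteHolonomy U x 0 1 * plaquetteHolonomy U (x.shift 0) 0 1) *
          Real.exp (-β * wilsonAction u1Rep U)) =
        (fun gf : Site 2 L → Circle => ENNReal.ofReal (φ (gf x * gf (x.shift 0))))
            (fun y => plaquetteHolonomy U y 0 1) * ∏ y, w (plaquetteHolonomy U y 0 1) := by
    intro U
    rw [ENNReal.ofReal_mul (hφnn _), ofReal_wilsonWeight_two_u1_eq_prod]
  simp_rw [hLpt]
  -- the puncture `x + e₁` is off the domino
  have hP : x.shift 1 ∉ ({x, x.shift 0} : Finset (Site 2 L)) := by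
    simp only [Finset.mem_insert, Finset.mem_singleton, not_or]
    exact ⟨site_shift_ne hL x 1, hx10⟩
  have hcard : ((Finset.univ.erase (x.shift 1)) \ ({x, x.shift 0} : Finset (Site 2 L))).card = L ^ 2 - 3 := by
    have hsub : ({x, x.shift 0} : Finset (Site 2 L)) ⊆ Finset.univ.erase (x.shift 1) := fun y hy =>
      Finset.mem_erase.2 ⟨fun h => hP (h ▸ hy), Finset.mem_univ _⟩
    rw [Finset.card_sdiff_of_subset hsub, Finset.card_erase_of_mem (Finset.mem_univ _), Finset.card_univ,
      Fintype.card_fun, ZMod.card, Fintype.card_fin, Finset.card_pair hx0]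
    omega
  rw [lintegral_weight_mul_eq_iterate hL hwm (u1W_symm β) (x.shift 1) {x, x.shift 0} hP
    (f := fun gf : Site 2 L → Circle => ENNReal.ofReal (φ (gf x * gf (x.shift 0))))
    ((hφm.comp ((measurable_pi_apply x).mul (measurable_pi_apply (x.shift 0)))).ennreal_ofReal)
    (fun g g' hgg' => by
      simp only [hgg' x (by simp), hgg' (x.shift 0) (by simp)]), hcard]
  simp only [Finset.prod_pair hx0]
  -- `∫∫ ψ(ab) w(a) w(b) = ∫ ψ (K_w w)` with `ψ = ofReal φ · K_w^{L²−3} w`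
  have hψm : Measurable fun u : Circle => ENNReal.ofReal (φ u) * (haarConv w)^[L ^ 2 - 3] w u :=
    hφm.ennreal_ofReal.mul (measurable_iterate hwm hwm _)
  have hre : ∀ g : Site 2 L → Circle,
      ENNReal.ofReal (φ (g x * g (x.shift 0))) * (w (g x) * w (g (x.shift 0))) *
          (haarConv w)^[L ^ 2 - 3] w (g x * g (x.shift 0)) =
        (fun u => ENNReal.ofReal (φ u) * (haarConv w)^[L ^ 2 - 3] w u) (g x * g (x.shift 0)) *
          (w (g x) * w (g (x.shift 0))) := fun g => by ring
  simp_rw [hre]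
  rw [lintegral_pair_weight_eq β x hx0 hψm]
  refine lintegral_congr fun u => ?_
  rw [ENNReal.ofReal_mul (hφnn _), ENNReal.ofReal_toReal (ne_top_of_le_ne_top ENNReal.one_ne_top (hKle _))]
  ring

end TwoDimU1

end Summit.Ventures.LatticeQCDFlow.Theory2.Autoregressive

end
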